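import Summits.BirchSwinnertonDyer.Rank1Residual.X11b.ClassClosureDisegniLever
import HarnessLib

/-!
# Class X11b, route "BDP + converse-theorem engine + Kolyvagin" (p2): the ONE-SIDED CYCLOTOMIC LEVER,
# part 1 — a DIVISIBILITY `char_Λ X ∣ ϖ·L_p` + Jones's leading term + the relative analytic leading
# term + ONE `p`-adic height per pair give the EULER-SYSTEM HALF `ord_p #Ш(E) ≤ ord_p #Ш(E)_an`, with
# NO (ram) prime and NO main-conjecture equality (cell `b2b-bsdres`, sub-cell `multr1-p2`, gen 21)

HONEST FRAMING (verbatim, cell `b2b-bsdres`, run/shared/lean/b2b/bsd-rank1-residual/): the goal of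
the cell is to DELETE the COMBINATION-SHAPED residual classes for ALL analytic-rank `≤ 1` curves
over `ℚ` — "full BSD formula for every rank `≤ 1` curve in class `C`" assembled STRICTLY from
published theorems — so that the rank-`≤ 1` remainder becomes exactly the CONSTRUCTION-SHAPED
classes, which are TYPED (missing-input Props), NOT attempted; this is not "finishing BSD".
Research route `p2` for class X11b (`ClassX11b W p := r_an = 1 ∧ p ≠ 2 ∧ mult(p) ∧ irr(p)`,
`Partition/Rows.lean`); no claim beyond the stated class and loci; nothing booked; X11b stays
CONSTRUCTION-SHAPED. THEOREMS ONLY (no definition, no named fact, no `sorry`). Every theorem is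
CONDITIONAL on the published named facts it lists, on THE open input of the route where stated, and
on the per-pair input `SchneiderConjecture Dh` / `ClassClosure.RegulatorNonvanishingAt W p`
(`Reg_p(E) ≠ 0` for THE canonical `p`-adic height: a finite `p`-adic computation per pair —
class-wide it is Schneider's conjecture, OPEN; barrier file
`Literature/Barriers/BirchSwinnertonDyer/PAdicHeightNondegeneracyProofs.lean`).

## What this file does (part 1 of 3: `BDPRouteCyclotomicLever` ⊂ `…LeverClass` ⊂ `…CyclotomicRecord`)

The statement of record of route p2 (`P2.bsdp_of_onTree_endState`, gen 18) types, besides THE open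
input (IMC≥∘BDP)ᵗ at `p ∥ N`, three Euler-system-half inputs with NO published road: (T2α′) on
`p ∣ ∏c ∧ (¬(ram) ∨ split ∧ p ∣ ord_p Δ)`, (T2♯-ℝ) the print-only Shimura displays, and (T3) the
main-conjecture half of the rank-`0` sister class X11a — the ONLY road the route had to the
Euler-system half on the ¬(ram) atom A3 (112 175 ‖ 6 637 class-wide pairs at `p ≥ 5`), and a road
for which no source, published or announced, exists (SU needs (ram)).

The class-closure lane (`X11b/ClassClosureDisegniLever.lean`, cc-typer-3, 2026-08-21) closes the
(ram) atom from Skinner 2016 Thm. A (main conjecture EQUALITY, needs (ram)) + Stein–Wuthrich 2013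
Thm. 6.1 (Jones) + Disegni 2020 Thm. 1 + ONE `p`-adic height per pair. Observation: the EULER-SYSTEM
half of that lever needs only a DIVISIBILITY `char_Λ X(E/ℚ_∞) ∣ ϖ·L_p` (at a split prime
`T·char ∣ ϖ·L_p`) — Kato's theorem at an odd multiplicative prime under an onto `p`-adic image
(Wuthrich 2014 Thm. 3; tree fact `kato_charIdeal_dvd_multiplicative_of_surjective`; NO (ram), NO
semistability): with `ϖ·L = ι(g)·ι(h)` (`g` a generator of `char_Λ X`, `h ∈ Λ` the cofactor),
Jones's leading term `[T¹]g · log_p(γ)^{1+e} · #E(ℚ)_tors² = u·ε·#Ш[p^∞]·Reg_p·∏c_v` (order exactly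
`1` GIVEN `Reg_p ≠ 0` and `Ш` finite — GZK) and the relative display
`ϖ·[T^{1+e}]L · log_p(γ)^{1+e} · #E(ℚ)_tors² = u'·ε·#Ш_an·Reg_p·∏c_v` give
`u'·#Ш_an = h(0)·u·#Ш[p^∞]` with `h(0) ∈ ℤ_p`, i.e. `ord_p #Ш(E) ≤ ord_p #Ш(E)_an`.

* §0 `padicValNat_le_padicValRat_of_leadingTerms` — the one-sided core (pure algebra: the cofactor
  lies in `ℤ_p`, not in `Λˣ`); `shaAn_ne_zero_of_analyticRank_ne_zero` (`#Ш_an ≠ 0` if `r_an ≠ 0`).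
* §1 datum level, every datum explicit: `finite_sha_and_padicValNat_shaOrder_le_of_nonsplit_divisibility`,
  `…_of_split_divisibility` — from `ι(g·h) = c·L` (resp. `ι(T·g·h) = c·L`), Jones's clause, the
  relative display at the pair and `SchneiderConjecture Dh`: `Ш(E)` finite and
  `ord_p #Ш(E) ≤ ord_p s` for THE rational `s = #Ш_an`.
Parts 2–3 (`BDPRouteCyclotomicLeverClass`, `BDPRouteCyclotomicRecord`) instantiate the data from
Kato's named fact and compose with the route. Labels UNCHANGED; nothing booked.

References: [Wuthrich2014] Thm. 3, Cor. 19; [Kato2004Asterisque] Thm. 17.4; [SteinWuthrich2013]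
Thm. 6.1, §4.2; [Disegni2020] Thm. 1 = Thm. 4, (∗); [Schneider1982PadicHeightI] §1;
[Miller2011LMS] Def. 1.1, Prop. 7.6; [GreenbergLNM1716] §4.
-/

set_option autoImplicit false

noncomputable section

open scoped Classical MatrixGroups ModularForm

open CongruenceSubgroup WeierstrassCurve
open Literature.NumberTheory.EllipticCurves
  Literature.NumberTheory.EllipticCurves.ModularForms
  Literature.NumberTheory.EllipticCurves.Rank1Residual
  Literature.NumberTheory.EllipticCurves.Rank1Residual.Typed
  Literature.NumberTheory.EllipticCurves.Wuthrich2014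
  Literature.NumberTheory.EllipticCurves.SteinWuthrich2013
  Literature.NumberTheory.EllipticCurves.Skinner2016

namespace Summit.BirchSwinnertonDyer.Rank1Residual.X11b

/-! ### §0. The one-sided core -/

/-- **One-sided core of the lever (pure algebra).** In `ℚ_p`: if `cL = gₙ · h₀` with `h₀ ∈ ℤ_p`
ARBITRARY (the order-`n` coefficient of `ι(g·h) = c·L` when `ord_T g ≥ n`, `h` the cofactor of a
DIVISIBILITY), `gₙ · B = u · (M · #S)` (algebraic leading term, `#S = #Ш[p^∞] ≠ 0`) and
`cL · B = u' · (M · s)` (analytic leading term against `s = #Ш_an ≠ 0`) with `M ≠ 0` and units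
`u, u'`, then `ord_p #S ≤ ord_p s` (the defect is `ord_p h₀ ≥ 0`). Compare
`padicValRat_eq_padicValNat_of_leadingTerms` (equality when `h₀` is a unit). [folklore] -/
theorem padicValNat_le_padicValRat_of_leadingTerms {p : ℕ} [Fact p.Prime] {gn h0 : ℤ_[p]}
    {cL B M : ℚ_[p]} (hM : M ≠ 0) {s : ℚ} (hs0 : s ≠ 0) {S : ℕ} (hS : S ≠ 0) (u u' : ℤ_[p]ˣ)
    (hι : cL = ((gn * h0 : ℤ_[p]) : ℚ_[p]))
    (hJ : ((gn : ℤ_[p]) : ℚ_[p]) * B = ((u : ℤ_[p]) : ℚ_[p]) * (M * (S : ℚ_[p])))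
    (hA : cL * B = ((u' : ℤ_[p]) : ℚ_[p]) * (M * (s : ℚ_[p]))) :
    (padicValNat p S : ℤ) ≤ padicValRat p s := by
  -- `u' · M · s = h₀ · u · M · S`
  have key : ((u' : ℤ_[p]) : ℚ_[p]) * (M * (s : ℚ_[p])) =
      ((h0 : ℤ_[p]) : ℚ_[p]) * ((u : ℤ_[p]) : ℚ_[p]) * (M * (S : ℚ_[p])) := by
    rw [← hA, hι]
    push_cast
    linear_combination ((h0 : ℤ_[p]) : ℚ_[p]) * hJ
  -- cancel `M`
  have key' : ((u' : ℤ_[p]) : ℚ_[p]) * (s : ℚ_[p]) =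
      ((h0 : ℤ_[p]) : ℚ_[p]) * ((u : ℤ_[p]) : ℚ_[p]) * (S : ℚ_[p]) := by
    apply mul_left_cancel₀ hM
    linear_combination key
  have hS0 : (S : ℚ_[p]) ≠ 0 := by exact_mod_cast hS
  have hs0' : (s : ℚ_[p]) ≠ 0 := by exact_mod_cast hs0
  have hlhs : ((u' : ℤ_[p]) : ℚ_[p]) * (s : ℚ_[p]) ≠ 0 :=
    mul_ne_zero (coe_units_ne_zero p u') hs0'
  have hh0 : ((h0 : ℤ_[p]) : ℚ_[p]) ≠ 0 := by
    intro e0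
    rw [e0, zero_mul, zero_mul] at key'
    exact hlhs key'
  have hval := congrArg Padic.valuation key'
  rw [Padic.valuation_mul (coe_units_ne_zero p u') hs0',
    Padic.valuation_mul (mul_ne_zero hh0 (coe_units_ne_zero p u)) hS0,
    Padic.valuation_mul hh0 (coe_units_ne_zero p u),
    valuation_coe_units_eq_zero, valuation_coe_units_eq_zero, Padic.valuation_ratCast,
    Padic.valuation_natCast] at hval
  have hh0val : 0 ≤ ((h0 : ℤ_[p]) : ℚ_[p]).valuation := PadicInt.valuation_coe_nonneg
  linarith

/-- **`#Ш(E)_an ≠ 0` in positive analytic rank** (unconditionally): the leading Taylor coefficient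
`L^{(r)}(E,1)/r!` is nonzero for `r = r_an ≠ 0` (`leadingLCoeff_ne_zero_of_analyticRank_ne_zero`),
and `Ω_E`, `∏ c_v`, `Reg(E/ℚ)`, `#E(ℚ)_tors` are positive (tree theorems). [folklore]
[cite: Miller2011LMS, §1 (arXiv:1010.2431 p. 3)] -/
theorem shaAn_ne_zero_of_analyticRank_ne_zero (W : WeierstrassCurve ℚ) [W.IsElliptic]
    (hr : W.analyticRank ≠ 0) : shaAn W ≠ 0 := by
  rw [shaAn_def]
  have hL : W.leadingLCoeff ≠ 0 :=
    Literature.NumberTheory.EllipticCurves.leadingLCoeff_ne_zero_of_analyticRank_ne_zero W hr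
  have hT : (W.torsionOrder : ℂ) ≠ 0 := by exact_mod_cast (W.torsionOrder_pos_holds).ne'
  have hΩ : (W.realPeriodRat : ℂ) ≠ 0 := by exact_mod_cast W.realPeriodRat_pos_holds.ne'
  have hc : (W.tamagawaProduct : ℂ) ≠ 0 := by
    exact_mod_cast (W.tamagawaProduct_pos_holds : 0 < W.tamagawaProduct).ne'
  have hR : (W.regulator : ℂ) ≠ 0 := by exact_mod_cast W.regulator_pos'.ne'
  exact div_ne_zero (mul_ne_zero hL (pow_ne_zero 2 hT)) (mul_ne_zero (mul_ne_zero hΩ hc) hR)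

/-! ### §1. Datum level: the Euler-system half at ONE pair from a DIVISIBILITY, every datum explicit -/

section Datum

variable (W : WeierstrassCurve ℚ) [W.IsElliptic] [W.IsGloballyMinimal] (p : ℕ) [Fact p.Prime]
  {κ : ZpExtension ℚ p} {γ : Field.absoluteGaloisGroup ℚ}

/-- **One-sided lever at one pair, NON-SPLIT multiplicative `p ≠ 2`, analytic rank `1`.** Data:
the Tate parameter `q`, cyclotomic `(κ, γ)`, a dual datum `D` of `Sel_{p^∞}(E/ℚ_∞)` (torsion), a
generator `g` of `char_Λ X`, a COFACTOR `h ∈ Λ` and `c ∈ ℚ_p` with `ι(g·h) = c·L` — a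
DIVISIBILITY `char_Λ X ∣ (c·L)` for THIS data (Kato; `c = ϖ`) —, THE §4.2 height `Dh`, THE rational
`s = #Ш_an`. Inputs: Jones's clause (`hJ`), GZK (`hGZK`: rank `1`, `Ш` finite), the relative
analytic display AT THE PAIR (`hDis`, with a unit `u'`: Disegni's Thm. 1 non-split, or any source)
and the per-pair input `SchneiderConjecture Dh`. Output: `Ш(E/ℚ)` is finite and
`ord_p #Ш(E/ℚ) ≤ ord_p s` — the EULER-SYSTEM half `ord_p #Ш ≤ ord_p #Ш_an`, for ANY `#Ш_an`, with
NO (ram), NO main-conjecture equality. CONDITIONAL; nothing booked.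
[cite: SteinWuthrich2013, Thm. 6.1 (p. 20) and §4.2] [cite: Disegni2020, Thm. 1 (§1.2)]
[cite: Miller2011LMS, Def. 1.1, Prop. 7.6] -/
theorem finite_sha_and_padicValNat_shaOrder_le_of_nonsplit_divisibility
    (hJ : thm61_nonsplitMultiplicative)
    (hGZK : rank_eq_analyticRank_of_analyticRank_le_one) (hp : p ≠ 2) (hr : W.analyticRank = 1)
    (hmult : W.HasMultiplicativeReductionAtPrime p) (hns : ¬ W.HasSplitMultiplicativeReductionAtPrime p)
    {q : ℚ_[p]} (hq0 : q ≠ 0) (hq1 : ‖q‖ < 1) (hqj : tateJ q = (W.j : ℚ_[p]))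
    (hκ : κ.IsCyclotomic) (hγ : κ.IsTopGenerator γ) (hγ' : IsCyclotomicVariable p γ)
    (D : W.SelmerDualData κ γ) (hX : D.IsTorsion) {g : IwasawaAlgebra p}
    (hchar : D.charIdeal = Ideal.span {g}) (h : IwasawaAlgebra p) {c : ℚ_[p]}
    {L : PowerSeries ℚ_[p]}
    (hdiv : iwasawaToPowerSeries p (g * h) = PowerSeries.C c * L)
    (Dh : PAdicHeightData W p) (hDh : IsMultCanonical Dh q)
    {s : ℚ} (hs : shaAn W = (s : ℂ)) (u' : ℤ_[p]ˣ)
    (hDis : c * PowerSeries.coeff 1 L * padicLog p (cyclotomicGenerator p) *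
        (W.torsionOrder : ℚ_[p]) ^ 2 =
      ((u' : ℤ_[p]) : ℚ_[p]) * (2 * ((s : ℚ_[p]) * padicRegulator Dh * W.tamagawaProduct)))
    (hSch : SchneiderConjecture Dh) :
    Finite W.sha ∧ (padicValNat p W.shaOrder : ℤ) ≤ padicValRat p s := by
  haveI : Module.Finite (IwasawaAlgebra p) D.X := D.module_finite_holds hγ
  obtain ⟨hrank, hfin⟩ := hGZK W (by omega)
  have hr1 : W.mordellWeilRank = 1 := by rw [hrank, hr]
  haveI : Finite W.sha := hfin
  haveI hfinp : Finite (AddCommGroup.primaryComponent W.sha p) := inferInstance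
  -- Jones: `ord_T g ≥ 1` and, granted `Reg_p ≠ 0` and `Ш` finite, the leading term at order `1`
  obtain ⟨hle, -, h3⟩ := hJ W p hp hmult hns q hq0 hq1 hqj κ γ hκ hγ hγ' D hX g hchar Dh hDh
  obtain ⟨u, hu⟩ := h3 hSch hfinp
  rw [hr1] at hle hu
  simp only [pow_one] at hu
  -- `c · [T¹]L = g₁ · h(0)` (the cofactor's constant term, an element of `ℤ_p`)
  have hι : c * PowerSeries.coeff 1 L =
      ((PowerSeries.coeff 1 g * PowerSeries.constantCoeff h : ℤ_[p]) : ℚ_[p]) := by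
    have := coeff_eq_mul_constantCoeff_of_le_order h hle 0 (c := c) (L := L) (by simpa using hdiv)
    simpa using this
  have hReg : padicRegulator Dh ≠ 0 := hSch
  have hc0 : (W.tamagawaProduct : ℚ_[p]) ≠ 0 := by
    exact_mod_cast (W.tamagawaProduct_pos_holds : 0 < W.tamagawaProduct).ne'
  have hM : (2 : ℚ_[p]) * padicRegulator Dh * (W.tamagawaProduct : ℚ_[p]) ≠ 0 :=
    mul_ne_zero (mul_ne_zero two_ne_zero hReg) hc0
  have hS : Nat.card (AddCommGroup.primaryComponent W.sha p) ≠ 0 := Nat.card_pos.ne'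
  have hs0 : s ≠ 0 := by
    intro h0
    exact shaAn_ne_zero_of_analyticRank_ne_zero W (by omega) (by rw [hs, h0]; simp)
  have hval : (padicValNat p (Nat.card (AddCommGroup.primaryComponent W.sha p)) : ℤ) ≤
      padicValRat p s :=
    padicValNat_le_padicValRat_of_leadingTerms (p := p) hM hs0 hS u u'
      (cL := c * PowerSeries.coeff 1 L)
      (B := padicLog p (cyclotomicGenerator p) * (W.torsionOrder : ℚ_[p]) ^ 2) hι
      (by linear_combination hu) (by linear_combination hDis)
  refine ⟨hfin, ?_⟩
  have hcard := padicValNat_card_addPrimaryComponent (A := W.sha) p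
  rw [WeierstrassCurve.shaOrder, ← hcard]
  exact hval

/-- **One-sided lever at one pair, SPLIT multiplicative `p ≠ 2`, analytic rank `1`.** As
`finite_sha_and_padicValNat_shaOrder_le_of_nonsplit_divisibility` with the exceptional-zero shapes:
the divisibility reads `ι(T·g·h) = c·L` (Kato / Kobayashi: `T·char ∣ ϖ·L_p`), Jones's clause carries
`𝓛_p = LInvariant Dq` and `log_p(γ)²`, and the relative display AT THE PAIR is
`c·[T²]L·log_p(γ)²·#T² = u'·𝓛_p·s·Reg_p·∏c` (Disegni Thm. 1 split: `p ≥ 5` + a second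
multiplicative prime; or any source). `𝓛_p ≠ 0` is the tree theorem `LInvariant_ne_zero_holds`.
CONDITIONAL; nothing booked. [cite: SteinWuthrich2013, Thm. 6.1 (p. 20) and §4.2]
[cite: Disegni2020, Thm. 4 second bullet (§3.2)] [cite: Miller2011LMS, Def. 1.1, Prop. 7.6] -/
theorem finite_sha_and_padicValNat_shaOrder_le_of_split_divisibility
    (hJ : thm61_splitMultiplicative)
    (hGZK : rank_eq_analyticRank_of_analyticRank_le_one) (hp : p ≠ 2) (hr : W.analyticRank = 1)
    (Dq : TateParameterData W p)
    (hκ : κ.IsCyclotomic) (hγ : κ.IsTopGenerator γ) (hγ' : IsCyclotomicVariable p γ)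
    (D : W.SelmerDualData κ γ) (hX : D.IsTorsion) {g : IwasawaAlgebra p}
    (hchar : D.charIdeal = Ideal.span {g}) (h : IwasawaAlgebra p) {c : ℚ_[p]}
    {L : PowerSeries ℚ_[p]}
    (hdiv : iwasawaToPowerSeries p ((PowerSeries.X : IwasawaAlgebra p) * g * h) =
      PowerSeries.C c * L)
    (Dh : PAdicHeightData W p) (hDh : IsSplitMultCanonical Dh Dq)
    {s : ℚ} (hs : shaAn W = (s : ℂ)) (u' : ℤ_[p]ˣ)
    (hDis : c * PowerSeries.coeff 2 L * padicLog p (cyclotomicGenerator p) ^ 2 *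
        (W.torsionOrder : ℚ_[p]) ^ 2 =
      ((u' : ℤ_[p]) : ℚ_[p]) *
        (LInvariant Dq * ((s : ℚ_[p]) * padicRegulator Dh * W.tamagawaProduct)))
    (hSch : SchneiderConjecture Dh) :
    Finite W.sha ∧ (padicValNat p W.shaOrder : ℤ) ≤ padicValRat p s := by
  haveI : Module.Finite (IwasawaAlgebra p) D.X := D.module_finite_holds hγ
  obtain ⟨hrank, hfin⟩ := hGZK W (by omega)
  have hr1 : W.mordellWeilRank = 1 := by rw [hrank, hr]
  haveI : Finite W.sha := hfin
  haveI hfinp : Finite (AddCommGroup.primaryComponent W.sha p) := inferInstance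
  -- Jones: `ord_T g ≥ 1` and the leading term at order `1` (split shape)
  obtain ⟨hle, -, h3⟩ := hJ W p hp Dq κ γ hκ hγ hγ' D hX g hchar Dh hDh
  obtain ⟨u, hu⟩ := h3 hSch hfinp
  rw [hr1] at hle hu
  -- `c · [T²]L = g₁ · h(0)`
  have hι : c * PowerSeries.coeff 2 L =
      ((PowerSeries.coeff 1 g * PowerSeries.constantCoeff h : ℤ_[p]) : ℚ_[p]) := by
    have := coeff_eq_mul_constantCoeff_of_le_order h hle 1 (c := c) (L := L) (by simpa using hdiv)
    simpa using this
  have hReg : padicRegulator Dh ≠ 0 := hSch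
  have h𝓛 : LInvariant Dq ≠ 0 := LInvariant_ne_zero_holds (W := W) (p := p) Dq
  have hc0 : (W.tamagawaProduct : ℚ_[p]) ≠ 0 := by
    exact_mod_cast (W.tamagawaProduct_pos_holds : 0 < W.tamagawaProduct).ne'
  have hM : LInvariant Dq * padicRegulator Dh * (W.tamagawaProduct : ℚ_[p]) ≠ 0 :=
    mul_ne_zero (mul_ne_zero h𝓛 hReg) hc0
  have hS : Nat.card (AddCommGroup.primaryComponent W.sha p) ≠ 0 := Nat.card_pos.ne'
  have hs0 : s ≠ 0 := by
    intro h0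
    exact shaAn_ne_zero_of_analyticRank_ne_zero W (by omega) (by rw [hs, h0]; simp)
  have hval : (padicValNat p (Nat.card (AddCommGroup.primaryComponent W.sha p)) : ℤ) ≤
      padicValRat p s :=
    padicValNat_le_padicValRat_of_leadingTerms (p := p) hM hs0 hS u u'
      (cL := c * PowerSeries.coeff 2 L)
      (B := padicLog p (cyclotomicGenerator p) ^ 2 * (W.torsionOrder : ℚ_[p]) ^ 2) hι
      (by linear_combination hu) (by linear_combination hDis)
  refine ⟨hfin, ?_⟩
  have hcard := padicValNat_card_addPrimaryComponent (A := W.sha) p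
  rw [WeierstrassCurve.shaOrder, ← hcard]
  exact hval

end Datum

end Summit.BirchSwinnertonDyer.Rank1Residual.X11b

end
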